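import Summits.QuantumFields.YangMills.Theses.ConvexGribovBody
import Literature.MathematicalPhysics.QuantumFieldTheory.LatticeGaugeProofs

/-!
# The slice Poincaré hypothesis holds at every time slice
(crux `ConvexGribovBody.PoincareToGap`, line `Sketch`, stub T1)

Torus `(ℤ/(2S+1))⁴`, time = coordinate `0`, Wilson state `μ = wilsonMeasure r.ρ β`, time
translations `T_v := torusConfigShift (Pi.single 0 v)`, `(T_v U)(x, i) = U(x - v e₀, i)`.
Write `X_s := {e | (e.1 0 - s).val = 0 ∧ e.2 ≠ 0}` for the spatial links based at time `s`
(`X_0 = {e | e.1 0 = 0 ∧ e.2 ≠ 0}`).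

`stub_sliceHypothesis_timeShift`: IF the crux hypothesis holds on this torus — the Poincaré
inequality `Var_μ f ≤ κ · Σ_{e ∈ X_0} ∫ (slope_e f)² dμ` for every gauge-invariant link-Lipschitz
`f` reading only the links of `X_0` — then for every `s : ℤ/(2S+1)` the same inequality holds for
every gauge-invariant link-Lipschitz `f` reading only the links of `X_s`, with the Dirichlet form
over `X_s`.

Proof.  Given such an `f`, the observable `g := f ∘ T_s` reads `X_0` (`(T_s U) e = U (e.1 - s e₀,
e.2)` and `e ∈ X_s ⇒ (e.1 - s e₀, e.2) ∈ X_0`), is gauge invariant (translations commute with gauge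
transformations up to translating the gauge function, `shift_gaugeTransform`) and link-Lipschitz
with the same constant (the Lipschitz gauge is a sum over all links, re-indexed by the edge
translation).  The hypothesis gives `Var g ≤ κ dir_0 g`.  By translation invariance of `μ`
(`wilsonMeasure_map_torusConfigShift`) `∫ g = ∫ f` and `Var g = Var f`.  For a link `e`,
`T_s (update U e k) = update (T_s U) ê k` with `ê = (e.1 + s e₀, e.2)` and `(T_s U) ê = U e`
(`shift_update`), so the difference functions `k ↦ g (update U e k) - g U` and
`k ↦ f (update (T_s U) ê k) - f (T_s U)` coincide and the metric slope of `g` at `(U, e)` is the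
metric slope of `f` at `(T_s U, ê)`; integrating with translation invariance,
`∫ (slope_e g)² dμ = ∫ (slope_ê f)² dμ`, and since `e ↦ ê` is a bijection `X_0 → X_s`
(`torusEdgeShift`), `dir_0 g = dir_s f`.  The main lemma `slicePoincare_shift` is stated for an
arbitrary `T_s`-invariant measure, an arbitrary `T_s`-invariant Lipschitz gauge `Λ` and an
arbitrary "slope" functional `sl f U e` depending on `(f, U, e)` only through the difference
function `k ↦ f (update U e k) - f U` and the value `U e` (the metric slope of the crux is such a
functional).

References: folklore (translation invariance of the periodic Wilson theory, K. Osterwalder,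
E. Seiler, Ann. Phys. 110 (1978) 440, §2).
-/

noncomputable section

open scoped BigOperators Topology
open MeasureTheory Filter
open Literature.MathematicalPhysics.QuantumFieldTheory

namespace Summit.QuantumFields.YangMills.Theorems.PoincareToGap

/-! ### Torus translations: single-link updates and gauge covariance -/

section Shifts

variable {d L : ℕ} {G : Type*} [MeasurableSpace G]

/-- Translating a configuration updated at the link `e` is updating the translated configuration
at the translated link `(e.1 + v, e.2)`. [folklore] -/
private theorem shift_update (v : Site d L) (U : GaugeConfig d L G) (e : Edge d L) (g : G) :
    torusConfigShift v (Function.update U e g) =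
      Function.update (torusConfigShift v U) (e.1 + v, e.2) g := by
  -- adapted from `ConvexGribovBodyPoincareToGapSliceCovSum.lean` (private there)
  funext e'
  rw [torusConfigShift_apply]
  by_cases h : e' = (e.1 + v, e.2)
  · subst h
    simp
  · rw [Function.update_of_ne h, torusConfigShift_apply, Function.update_of_ne]
    rintro rfl
    exact h (by simp)

/-- Translations commute with gauge transformations up to translating the gauge function.
[folklore] -/
private theorem shift_gaugeTransform [Group G] (v : Site d L) (g : Site d L → G)
    (U : GaugeConfig d L G) :
    torusConfigShift v (gaugeTransform g U) =
      gaugeTransform (fun x => g (x - v)) (torusConfigShift v U) := by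
  -- adapted from `ConvexGribovBodyPoincareToGapSliceCovSum.lean` (private there)
  funext e
  simp only [torusConfigShift_apply, gaugeTransform, Site.shift, sub_add_eq_add_sub]

end Shifts

/-! ### The main lemma: an arbitrary `T_s`-invariant measure -/

/-- **Main lemma.**  Let `μ` be a measure on `GaugeConfig 4 (2S+1) G` invariant under the time
translation `T_s`, `Λ U V` a `T_s`-invariant gauge of the distance of two configurations, and
`sl f U e` a functional of `(f, U, e)` depending only on the difference function
`k ↦ f (update U e k) - f U` and on `U e`.  If every gauge-invariant `Λ`-Lipschitz `f` reading
only the time-zero spatial links satisfies `Var_μ f ≤ κ Σ_{e ∈ X_0} ∫ (sl f U e)² dμ`, then every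
gauge-invariant `Λ`-Lipschitz `f` reading only the time-`s` spatial links satisfies
`Var_μ f ≤ κ Σ_{e ∈ X_s} ∫ (sl f U e)² dμ`. [folklore] -/
private theorem slicePoincare_shift {G : Type*} [Group G] [MeasurableSpace G] {S : ℕ}
    (μ : Measure (GaugeConfig 4 (2 * S + 1) G)) (s : ZMod (2 * S + 1))
    (hμ : μ.map (torusConfigShift (Pi.single (0 : Fin 4) s : Site 4 (2 * S + 1))) = μ)
    (Λ : GaugeConfig 4 (2 * S + 1) G → GaugeConfig 4 (2 * S + 1) G → ℝ)
    (hΛ : ∀ U V : GaugeConfig 4 (2 * S + 1) G,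
      Λ (torusConfigShift (Pi.single (0 : Fin 4) s : Site 4 (2 * S + 1)) U)
        (torusConfigShift (Pi.single (0 : Fin 4) s : Site 4 (2 * S + 1)) V) = Λ U V)
    (sl : (GaugeConfig 4 (2 * S + 1) G → ℝ) → GaugeConfig 4 (2 * S + 1) G →
      Edge 4 (2 * S + 1) → ℝ)
    (hsl : ∀ (f f' : GaugeConfig 4 (2 * S + 1) G → ℝ) (U U' : GaugeConfig 4 (2 * S + 1) G)
      (e e' : Edge 4 (2 * S + 1)),
      (∀ g, f (Function.update U e g) - f U = f' (Function.update U' e' g) - f' U') →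
      U e = U' e' → sl f U e = sl f' U' e')
    (κ : ℝ)
    (hP : ∀ f : GaugeConfig 4 (2 * S + 1) G → ℝ, IsGaugeInvariant f →
      (∀ U V : GaugeConfig 4 (2 * S + 1) G,
        (∀ e : Edge 4 (2 * S + 1), e.1 0 = 0 → e.2 ≠ 0 → U e = V e) → f U = f V) →
      (∃ K : ℝ, ∀ U V : GaugeConfig 4 (2 * S + 1) G, |f U - f V| ≤ K * Λ U V) →
      ∫ U, (f U - ∫ V, f V ∂μ) ^ 2 ∂μ ≤
        κ * ∑ e : Edge 4 (2 * S + 1),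
          (if e.1 0 = 0 ∧ e.2 ≠ 0 then ∫ U, (sl f U e) ^ 2 ∂μ else 0))
    (f : GaugeConfig 4 (2 * S + 1) G → ℝ) (hfg : IsGaugeInvariant f)
    (hfd : ∀ U V : GaugeConfig 4 (2 * S + 1) G,
      (∀ e : Edge 4 (2 * S + 1), (e.1 0 - s).val = 0 → e.2 ≠ 0 → U e = V e) → f U = f V)
    (hfl : ∃ K : ℝ, ∀ U V : GaugeConfig 4 (2 * S + 1) G, |f U - f V| ≤ K * Λ U V) :
    ∫ U, (f U - ∫ V, f V ∂μ) ^ 2 ∂μ ≤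
      κ * ∑ e : Edge 4 (2 * S + 1),
        (if (e.1 0 - s).val = 0 ∧ e.2 ≠ 0 then ∫ U, (sl f U e) ^ 2 ∂μ else 0) := by
  obtain ⟨K, hK⟩ := hfl
  -- change of variables under the time translation
  have hInv : ∀ F : GaugeConfig 4 (2 * S + 1) G → ℝ,
      ∫ U, F (torusConfigShift (Pi.single (0 : Fin 4) s : Site 4 (2 * S + 1)) U) ∂μ =
        ∫ U, F U ∂μ := fun F => by
    rw [← integral_map_equiv, hμ]
  -- the translated observable
  obtain ⟨g, hg⟩ : ∃ g : GaugeConfig 4 (2 * S + 1) G → ℝ, g = fun U =>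
      f (torusConfigShift (Pi.single (0 : Fin 4) s : Site 4 (2 * S + 1)) U) := ⟨_, rfl⟩
  -- (a) it is gauge invariant
  have hgg : IsGaugeInvariant g := fun h U => by
    simp only [hg, shift_gaugeTransform]
    exact hfg _ _
  -- (b) it reads only time-zero spatial links
  have hgd : ∀ U V : GaugeConfig 4 (2 * S + 1) G,
      (∀ e : Edge 4 (2 * S + 1), e.1 0 = 0 → e.2 ≠ 0 → U e = V e) → g U = g V := by
    intro U V hUV
    simp only [hg]
    refine hfd _ _ fun e he1 he2 => ?_
    simp only [torusConfigShift_apply]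
    refine hUV _ ?_ he2
    simpa only [Pi.sub_apply, Pi.single_eq_same, ZMod.val_eq_zero] using he1
  -- (c) it is Lipschitz with the same constant
  have hgl : ∃ K' : ℝ, ∀ U V : GaugeConfig 4 (2 * S + 1) G, |g U - g V| ≤ K' * Λ U V := by
    refine ⟨K, fun U V => ?_⟩
    simp only [hg]
    exact (hK _ _).trans_eq (by rw [hΛ])
  -- the Poincaré inequality for `g`
  have hPg := hP g hgg hgd hgl
  -- MEAN and VARIANCE of the translate
  have hmean : ∫ V, g V ∂μ = ∫ V, f V ∂μ := by
    simp only [hg]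
    exact hInv f
  have hvar : ∫ U, (g U - ∫ V, g V ∂μ) ^ 2 ∂μ = ∫ U, (f U - ∫ V, f V ∂μ) ^ 2 ∂μ := by
    rw [hmean]
    simp only [hg]
    exact hInv fun U => (f U - ∫ V, f V ∂μ) ^ 2
  -- DIRICHLET FORM of the translate, link by link
  have hterm : ∀ e : Edge 4 (2 * S + 1), ∫ U, (sl g U e) ^ 2 ∂μ =
      ∫ U, (sl f U (e.1 + Pi.single (0 : Fin 4) s, e.2)) ^ 2 ∂μ := fun e => by
    have h1 : ∀ U, sl g U e =
        sl f (torusConfigShift (Pi.single (0 : Fin 4) s : Site 4 (2 * S + 1)) U)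
          (e.1 + Pi.single (0 : Fin 4) s, e.2) := fun U =>
      hsl _ _ _ _ _ _ (fun k => by simp only [hg, shift_update])
        (by simp [torusConfigShift_apply])
    simp_rw [h1]
    exact hInv fun V => (sl f V (e.1 + Pi.single (0 : Fin 4) s, e.2)) ^ 2
  have hdir : ∑ e : Edge 4 (2 * S + 1),
        (if e.1 0 = 0 ∧ e.2 ≠ 0 then ∫ U, (sl g U e) ^ 2 ∂μ else 0) =
      ∑ e : Edge 4 (2 * S + 1),
        (if (e.1 0 - s).val = 0 ∧ e.2 ≠ 0 then ∫ U, (sl f U e) ^ 2 ∂μ else 0) := by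
    simp_rw [hterm]
    refine Fintype.sum_equiv
      (torusEdgeShift (Pi.single (0 : Fin 4) s : Site 4 (2 * S + 1))) _ _ fun e => ?_
    simp only [torusEdgeShift_apply, Pi.add_apply, Pi.single_eq_same, add_sub_cancel_right,
      ZMod.val_eq_zero]
  -- conclusion
  rw [← hvar, ← hdir]
  exact hPg

/-! ### The registered stub -/

/-- **T1 `stub_sliceHypothesis_timeShift`** (crux `ConvexGribovBody.PoincareToGap`, line
`Sketch`): on one torus `(2S+1)⁴`, IF the crux hypothesis — the slice Poincaré inequality with
constant `κ` for gauge-invariant link-Lipschitz functions of the time-ZERO spatial links, with the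
metric-slope Dirichlet form over `X_0 = {e | e.1 0 = 0 ∧ e.2 ≠ 0}` — holds at this `S` for
`μ = wilsonMeasure r.ρ β`, THEN for every `s : ℤ/(2S+1)` the same inequality holds for every
gauge-invariant link-Lipschitz `f` reading only the time-`s` spatial links, with the Dirichlet
form over `X_s = {e | (e.1 0 - s).val = 0 ∧ e.2 ≠ 0}`.  Instance of `slicePoincare_shift` with
`μ = wilsonMeasure r.ρ β` (time-translation invariance `wilsonMeasure_map_torusConfigShift`), the
Frobenius Lipschitz gauge and the metric slope. [folklore] -/
theorem stub_sliceHypothesis_timeShift :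
    ∀ (G : Type) [Group G] [TopologicalSpace G] [IsTopologicalGroup G] [CompactSpace G]
      [MeasurableSpace G] [BorelSpace G] (r : LatticeRep G) (β κ : ℝ) (S : ℕ),
    (∀ f : GaugeConfig 4 (2 * S + 1) G → ℝ, IsGaugeInvariant f →
      (∀ U V : GaugeConfig 4 (2 * S + 1) G,
        (∀ e : Edge 4 (2 * S + 1), e.1 0 = 0 → e.2 ≠ 0 → U e = V e) → f U = f V) →
      (∃ K : ℝ, ∀ U V : GaugeConfig 4 (2 * S + 1) G,
        |f U - f V| ≤ K * ∑ e, Real.sqrt (∑ a, ∑ b, ‖(r.ρ (U e) - r.ρ (V e)) a b‖ ^ 2)) →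
      ∫ U, (f U - ∫ V, f V ∂(wilsonMeasure r.ρ β : Measure (GaugeConfig 4 (2 * S + 1) G))) ^ 2
          ∂(wilsonMeasure r.ρ β : Measure (GaugeConfig 4 (2 * S + 1) G)) ≤
        κ * ∑ e : Edge 4 (2 * S + 1), (if e.1 0 = 0 ∧ e.2 ≠ 0 then
          ∫ U, (Filter.limsup (fun g : G => |f (Function.update U e g) - f U| /
              Real.sqrt (∑ a, ∑ b, ‖(r.ρ g - r.ρ (U e)) a b‖ ^ 2)) (𝓝[≠] (U e))) ^ 2
            ∂(wilsonMeasure r.ρ β : Measure (GaugeConfig 4 (2 * S + 1) G)) else 0)) →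
    ∀ μ : Measure (GaugeConfig 4 (2 * S + 1) G),
      μ = (wilsonMeasure r.ρ β : Measure (GaugeConfig 4 (2 * S + 1) G)) →
    ∀ (s : ZMod (2 * S + 1)) (f : GaugeConfig 4 (2 * S + 1) G → ℝ), IsGaugeInvariant f →
      (∀ U V : GaugeConfig 4 (2 * S + 1) G,
        (∀ e : Edge 4 (2 * S + 1), (e.1 0 - s).val = 0 → e.2 ≠ 0 → U e = V e) → f U = f V) →
      (∃ K : ℝ, ∀ U V : GaugeConfig 4 (2 * S + 1) G,
        |f U - f V| ≤ K * ∑ e, Real.sqrt (∑ a, ∑ b, ‖(r.ρ (U e) - r.ρ (V e)) a b‖ ^ 2)) →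
      ∫ U, (f U - ∫ V, f V ∂μ) ^ 2 ∂μ ≤
        κ * ∑ e : Edge 4 (2 * S + 1), (if (e.1 0 - s).val = 0 ∧ e.2 ≠ 0 then
          ∫ U, (Filter.limsup (fun g : G => |f (Function.update U e g) - f U| /
              Real.sqrt (∑ a, ∑ b, ‖(r.ρ g - r.ρ (U e)) a b‖ ^ 2)) (𝓝[≠] (U e))) ^ 2 ∂μ else 0) := by
  intro G _ _ _ _ _ _ r β κ S hP μ hμ s f hfg hfd hfl
  subst hμ
  exact slicePoincare_shift (S := S) (wilsonMeasure r.ρ β) s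
    (wilsonMeasure_map_torusConfigShift r.ρ β _)
    (fun U V => ∑ e, Real.sqrt (∑ a, ∑ b, ‖(r.ρ (U e) - r.ρ (V e)) a b‖ ^ 2))
    (fun U V => Fintype.sum_equiv
      (torusEdgeShift (Pi.single (0 : Fin 4) s : Site 4 (2 * S + 1))).symm _ _ fun e => by
        simp only [torusConfigShift_apply, torusEdgeShift_symm_apply])
    (fun f U e => Filter.limsup (fun g : G => |f (Function.update U e g) - f U| /
      Real.sqrt (∑ a, ∑ b, ‖(r.ρ g - r.ρ (U e)) a b‖ ^ 2)) (𝓝[≠] (U e)))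
    (fun f f' U U' e e' h1 h2 => by simp only [h1, h2]) κ hP f hfg hfd hfl

end Summit.QuantumFields.YangMills.Theorems.PoincareToGap

end
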